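import Summits.CriticalPhenomena.CardyFormulaZ2.Theorems.DyadicLatticeBetaLaw.Negative.DyadicLatticeBetaLawFalseWithoutUniformizing
import Summits.CriticalPhenomena.CardyFormulaZ2.Theorems.CardyWhiteToColouredSimilarityUpgradeStubRectangleDuality
import Literature.Barriers.CriticalPhenomena.QuarterTurnResistorLaw
import Literature.Probability.RandomPlanarGeometry.CardyFunctionIncBeta

/-!
# Line `Sketch` of crux `DyadicLatticeBetaLaw` (stmt-CriticalPhenomena-18183): the modulus hypotheses
# of STUB S1 `stub_equicontinuousComparison` are load-bearing, and S1 follows from `CardyFormulaZ2`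
# (negative-side support, cdisprove seat; no definition introduced)

STUB S1 of the lead's registered skeleton `Cruxes/DyadicLatticeBetaLaw/Lines/Sketch.lean`
(equicontinuous equimodular comparison): `∀ ε > 0, ∀ η ∈ (0,1), ∃ θ > 0`, any two lattice polygons
`R` (of `hℤ²`) and `R'` (of `h'ℤ²`) with uniformizing data of cross-ratios `θ`-close to `η` have
`|P[R, h/2^k] - P[R', h'/2^k]| < ε` for all large `k`.

* `stub_equicontinuousComparison_of_cardyFormulaZ2` — **`CardyFormulaZ2 → S1`** (uniform continuity of
  Cardy's `F` on `[0,1]`, tree `continuousOn_cardyFunction_holds`): like the crux, S1 is not refutable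
  short of `¬ CardyFormulaZ2`; it is exactly as strong as it should be.
* `stub_equicontinuousComparison_false_without_modulus` — **the two hypotheses
  `|crossRatio x - η| < θ`, `|crossRatio x' - η| < θ` are load-bearing**: with them dropped (statement
  inline), the unit square (`P ≥ 1/2` at every mesh `1/(n+3)`: `half_le_bond_unitSquare`, from the
  tree's `le_bond_bt` and self-duality `crossingProb_half_succ_self_holds`) and the thin box
  `(0,1/4) × (0,1)` (`P ≤ 1/8` at every mesh `1/(4(n+2))`: `bond_thinBox_le`, from `bond_bt_le`,
  `crossingProb_anti_left` and `LongBoxHalving_holds`) are lattice polygons of `ℤ²` resp. `(1/4)ℤ²`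
  (`isLatticePolygon_box`) whose dyadic crossing probabilities stay `≥ 3/8` apart.
* `dyadicConsistency_of_stub_equicontinuousComparison` — the cheapest consequence of S1 beyond
  RSW/duality: dyadic ×2-consistency `P[R, h/2^k] - P[R, h/2^(k+1)] → 0` for every lattice polygon
  presented at meshes `h` and `h/2` (open already for the `2 × 1` rectangle).

This file does NOT refute S1 or the crux.
-/

noncomputable section

namespace Summit.CriticalPhenomena.CardyFormulaZ2.Theorems.DyadicLatticeBetaLaw.Negative

open Filter Topology Set
open Literature.Probability.RandomPlanarGeometry Literature.Probability.Percolation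
open Literature.Probability.LatticeModels
open Summit.CriticalPhenomena.CardyFormulaZ2.Cruxes.SimilarityUpgrade.Stubs.RectangleDuality
  (bond_bt_le le_bond_bt real_shift_tbCrossing)

/-! ### `CardyFormulaZ2 → S1` -/

/-- **`CardyFormulaZ2 → S1`** (S1 = `stub_equicontinuousComparison` of line `Sketch`, verbatim):
under Cardy's formula both sequences converge to `F(η_R)`, `F(η_{R'})`, and `F` is uniformly continuous
on `[0,1]`. [folklore] -/
theorem stub_equicontinuousComparison_of_cardyFormulaZ2 (hS : _root_.CardyFormulaZ2) :
    ∀ ε : ℝ, 0 < ε → ∀ η ∈ Set.Ioo (0 : ℝ) 1, ∃ θ : ℝ, 0 < θ ∧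
      ∀ h h' : ℝ, 0 < h → 0 < h' → ∀ R R' : ConformalRectangle,
        (∃ S : Finset (ℂ × ℂ), (∀ p ∈ S, ∃ u v : Site 2, (zdGraph 2).Adj u v ∧
            p.1 = meshPoint h u ∧ p.2 = meshPoint h v) ∧
            frontier R.carrier ⊆ ⋃ p ∈ S, segment ℝ p.1 p.2) →
        (∃ S : Finset (ℂ × ℂ), (∀ p ∈ S, ∃ u v : Site 2, (zdGraph 2).Adj u v ∧
            p.1 = meshPoint h' u ∧ p.2 = meshPoint h' v) ∧
            frontier R'.carrier ⊆ ⋃ p ∈ S, segment ℝ p.1 p.2) →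
        ∀ (φ : ConformalEquiv UpperHalfPlane.upperHalfPlaneSet R.carrier) (x : Fin 4 → ℝ)
          (φ' : ConformalEquiv UpperHalfPlane.upperHalfPlaneSet R'.carrier) (x' : Fin 4 → ℝ),
          R.IsUniformizing φ x → R'.IsUniformizing φ' x' →
          |crossRatio x - η| < θ → |crossRatio x' - η| < θ →
          ∀ᶠ k : ℕ in atTop,
            |bondDomainCrossingProb R (h / 2 ^ k) - bondDomainCrossingProb R' (h' / 2 ^ k)| < ε := by
  -- dyadic meshes tend to `0⁺` (cf. `PolyominoGaussianLaw.Birth.tendsto_dyadicMesh`, not imported here)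
  have tendsto_dyadicMesh_nhdsGT : ∀ {d : ℝ}, 0 < d →
      Tendsto (fun k : ℕ => d / 2 ^ k) atTop (𝓝[>] (0 : ℝ)) := fun hd => by
    rw [tendsto_nhdsWithin_iff]
    exact ⟨tendsto_const_nhds.div_atTop (tendsto_pow_atTop_atTop_of_one_lt one_lt_two),
      Eventually.of_forall fun k => div_pos hd (pow_pos two_pos k)⟩
  intro ε hε η _
  obtain ⟨θ, hθ, hU⟩ := Metric.uniformContinuousOn_iff.1
    (isCompact_Icc.uniformContinuousOn_of_continuous continuousOn_cardyFunction_holds) (ε / 2)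
    (half_pos hε)
  refine ⟨θ / 2, half_pos hθ, ?_⟩
  intro h h' hh hh' R R' _ _ φ x φ' x' hφ hφ' hx hx'
  have hηR := ConformalRectangle.crossRatio_mem_Ioo_of_isUniformizing hφ
  have hηR' := ConformalRectangle.crossRatio_mem_Ioo_of_isUniformizing hφ'
  have hF : dist (Literature.Probability.RandomPlanarGeometry.cardyFunction (crossRatio x))
      (Literature.Probability.RandomPlanarGeometry.cardyFunction (crossRatio x')) < ε / 2 := by
    refine hU _ (Ioo_subset_Icc_self hηR) _ (Ioo_subset_Icc_self hηR') ?_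
    rw [Real.dist_eq]
    calc |crossRatio x - crossRatio x'| = |(crossRatio x - η) - (crossRatio x' - η)| := by ring_nf
      _ ≤ |crossRatio x - η| + |crossRatio x' - η| := abs_sub _ _
      _ < θ := by linarith
  have hT := Metric.tendsto_nhds.1 ((hS R φ x hφ).comp (tendsto_dyadicMesh_nhdsGT hh)) (ε / 4)
    (by positivity)
  have hT' := Metric.tendsto_nhds.1 ((hS R' φ' x' hφ').comp (tendsto_dyadicMesh_nhdsGT hh')) (ε / 4)
    (by positivity)
  filter_upwards [hT, hT'] with k hk hk'
  rw [Function.comp_apply, Real.dist_eq] at hk hk'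
  rw [Real.dist_eq] at hF
  have e1 := abs_lt.1 hk
  have e2 := abs_lt.1 hk'
  have e3 := abs_lt.1 hF
  rw [abs_lt]
  constructor <;> linarith [e1.1, e1.2, e2.1, e2.2, e3.1, e3.2]

/-- **S1 ⇒ dyadic ×2-consistency**: for a lattice polygon presented at meshes `h` and `h/2`,
`P[R, h/2^k] - P[R, h/2^(k+1)] → 0` (S1 with `R' = R`, `h' = h/2`, `η = η_R`). [folklore] -/
theorem dyadicConsistency_of_stub_equicontinuousComparison
    (hS1 : ∀ ε : ℝ, 0 < ε → ∀ η ∈ Set.Ioo (0 : ℝ) 1, ∃ θ : ℝ, 0 < θ ∧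
      ∀ h h' : ℝ, 0 < h → 0 < h' → ∀ R R' : ConformalRectangle,
        (∃ S : Finset (ℂ × ℂ), (∀ p ∈ S, ∃ u v : Site 2, (zdGraph 2).Adj u v ∧
            p.1 = meshPoint h u ∧ p.2 = meshPoint h v) ∧
            frontier R.carrier ⊆ ⋃ p ∈ S, segment ℝ p.1 p.2) →
        (∃ S : Finset (ℂ × ℂ), (∀ p ∈ S, ∃ u v : Site 2, (zdGraph 2).Adj u v ∧
            p.1 = meshPoint h' u ∧ p.2 = meshPoint h' v) ∧
            frontier R'.carrier ⊆ ⋃ p ∈ S, segment ℝ p.1 p.2) →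
        ∀ (φ : ConformalEquiv UpperHalfPlane.upperHalfPlaneSet R.carrier) (x : Fin 4 → ℝ)
          (φ' : ConformalEquiv UpperHalfPlane.upperHalfPlaneSet R'.carrier) (x' : Fin 4 → ℝ),
          R.IsUniformizing φ x → R'.IsUniformizing φ' x' →
          |crossRatio x - η| < θ → |crossRatio x' - η| < θ →
          ∀ᶠ k : ℕ in atTop,
            |bondDomainCrossingProb R (h / 2 ^ k) - bondDomainCrossingProb R' (h' / 2 ^ k)| < ε)
    {h : ℝ} (hh : 0 < h) (R : ConformalRectangle)
    (hR : ∃ S : Finset (ℂ × ℂ), (∀ p ∈ S, ∃ u v : Site 2, (zdGraph 2).Adj u v ∧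
        p.1 = meshPoint h u ∧ p.2 = meshPoint h v) ∧ frontier R.carrier ⊆ ⋃ p ∈ S, segment ℝ p.1 p.2)
    (hR' : ∃ S : Finset (ℂ × ℂ), (∀ p ∈ S, ∃ u v : Site 2, (zdGraph 2).Adj u v ∧
        p.1 = meshPoint (h / 2) u ∧ p.2 = meshPoint (h / 2) v) ∧
        frontier R.carrier ⊆ ⋃ p ∈ S, segment ℝ p.1 p.2)
    (φ : ConformalEquiv UpperHalfPlane.upperHalfPlaneSet R.carrier) (x : Fin 4 → ℝ)
    (hφ : R.IsUniformizing φ x) (ε : ℝ) (hε : 0 < ε) :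
    ∀ᶠ k : ℕ in atTop,
      |bondDomainCrossingProb R (h / 2 ^ k) - bondDomainCrossingProb R (h / 2 ^ (k + 1))| < ε := by
  have hη := ConformalRectangle.crossRatio_mem_Ioo_of_isUniformizing hφ
  obtain ⟨θ, hθ, H⟩ := hS1 ε hε (crossRatio x) hη
  have hev := H h (h / 2) hh (half_pos hh) R R hR hR' φ x φ x hφ hφ (by simpa using hθ)
    (by simpa using hθ)
  filter_upwards [hev] with k hk
  have e : h / 2 / 2 ^ k = h / 2 ^ (k + 1) := by rw [pow_succ]; ring
  rwa [e] at hk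

/-! ### The two lattice polygons: the unit square and the thin box `(0, 1/4) × (0, 1)` -/

/-- The thin box `(0, 1/4) × (0, 1)` (corner-marked) is a lattice polygon of `(1/4)ℤ²`. [folklore] -/
theorem thinBox_isLatticePolygon :
    ∃ S : Finset (ℂ × ℂ), (∀ p ∈ S, ∃ u v : Site 2, (zdGraph 2).Adj u v ∧ p.1 = meshPoint (1 / 4) u ∧
      p.2 = meshPoint (1 / 4) v) ∧
      frontier (rectQuad 0 (1 / 4) 0 1 (by norm_num) zero_lt_one).carrier ⊆
        ⋃ p ∈ S, segment ℝ p.1 p.2 :=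
  isLatticePolygon_box (M := 1) (N := 4) (by norm_num) one_pos (by norm_num) _
    (by rw [rectQuad_carrier]; norm_num)

/-- **The unit square is crossed (bottom-to-top) with probability `≥ 1/2` at every mesh `1/(n+3)`**:
its crossing event contains the bottom–top crossing of the shifted lattice box `[0, n] × [0, n+1]`,
of probability `crossingProb half (n+1) n = 1/2` (self-duality). [cite: BollobasRiordan2006, Ch. 3 Lemma 1 and Cor. 3] -/
theorem half_le_bond_unitSquare (n : ℕ) :
    1 / 2 ≤ bondDomainCrossingProb (rectQuad 0 1 0 1 zero_lt_one zero_lt_one) (1 / ((n : ℝ) + 3)) := by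
  have hn : (0 : ℝ) < n + 3 := by positivity
  have hδ : (0 : ℝ) < 1 / (n + 3) := by positivity
  have ha : 1 / ((n : ℝ) + 3) * ((n + 1 : ℕ) + 1) < 1 := by
    rw [div_mul_eq_mul_div, one_mul, div_lt_one hn]; push_cast; linarith
  have ha' : (1 : ℝ) ≤ 1 / ((n : ℝ) + 3) * ((n + 1 : ℕ) + 2) := by
    rw [div_mul_eq_mul_div, one_mul, le_div_iff₀ hn]; push_cast; linarith
  have hb : 1 / ((n : ℝ) + 3) * ((n + 1 : ℕ) + 2) = 1 := by
    push_cast; field_simp; ring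
  have h0 : (rectQuad 0 1 0 1 zero_lt_one zero_lt_one).arc 0 = {z : ℂ | z.im = 0 ∧ z.re ∈ Icc (0 : ℝ) 1} := by
    ext z; exact mem_rectQuad_arc_zero zero_lt_one zero_lt_one
  have h2 : (rectQuad 0 1 0 1 zero_lt_one zero_lt_one).arc 2 = {z : ℂ | z.im = 1 ∧ z.re ∈ Icc (0 : ℝ) 1} := by
    ext z; exact mem_rectQuad_arc_two zero_lt_one zero_lt_one
  have hlow := le_bond_bt (rectQuad 0 1 0 1 zero_lt_one zero_lt_one) (rectQuad_carrier _ _) h0 h2 hδ ha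
    ha' hb (a' := n) le_rfl
  rw [real_shift_tbCrossing] at hlow
  rw [← crossingProb_half_succ_self_holds n]
  exact hlow

/-- **The thin box `(0, 1/4) × (0, 1)` is crossed bottom-to-top with probability `≤ 1/8` at every
mesh `1/(4(n+2))`**: its crossing event is contained in the bottom–top crossing of the shifted lattice
box `[0, n] × [0, 4n+6]`, a left–right crossing of `[0, 4n+6] × [0, n]` after transposition, of
probability `≤ crossingProb half (3(n+2)-1) n ≤ (1/2)³` (`LongBoxHalving_holds`).
[cite: BollobasRiordan2006, Ch. 3 §3.4] -/
theorem bond_thinBox_le (n : ℕ) :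
    bondDomainCrossingProb (rectQuad 0 (1 / 4) 0 1 (by norm_num) zero_lt_one)
      (1 / (4 * ((n : ℝ) + 2))) ≤ 1 / 8 := by
  have hn : (0 : ℝ) < 4 * (n + 2) := by positivity
  have hδ : (0 : ℝ) < 1 / (4 * (n + 2)) := by positivity
  have ha : 1 / (4 * ((n : ℝ) + 2)) * ((n : ℕ) + 1) < 1 / 4 := by
    rw [div_mul_eq_mul_div, one_mul, div_lt_iff₀ hn]; linarith
  have ha' : (1 : ℝ) / 4 ≤ 1 / (4 * ((n : ℝ) + 2)) * ((n : ℕ) + 2) := by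
    rw [div_mul_eq_mul_div, one_mul, le_div_iff₀ hn]; linarith
  have hb : 1 / (4 * ((n : ℝ) + 2)) * ((4 * n + 6 : ℕ) + 2) = 1 := by
    push_cast; field_simp; ring
  have h0 : (rectQuad 0 (1 / 4) 0 1 (by norm_num) zero_lt_one).arc 0 =
      {z : ℂ | z.im = 0 ∧ z.re ∈ Icc (0 : ℝ) (1 / 4)} := by
    ext z; exact mem_rectQuad_arc_zero (by norm_num) zero_lt_one
  have h2 : (rectQuad 0 (1 / 4) 0 1 (by norm_num) zero_lt_one).arc 2 =
      {z : ℂ | z.im = 1 ∧ z.re ∈ Icc (0 : ℝ) (1 / 4)} := by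
    ext z; exact mem_rectQuad_arc_two (by norm_num) zero_lt_one
  have hup := bond_bt_le (rectQuad 0 (1 / 4) 0 1 (by norm_num) zero_lt_one) (rectQuad_carrier _ _) h0 h2
    hδ ha ha' hb
  rw [real_shift_tbCrossing] at hup
  refine hup.trans ?_
  have h1 : crossingProb half (4 * n + 6) n ≤ crossingProb half (3 * (n + 2) - 1) n :=
    crossingProb_anti_left half (by omega) n
  exact h1.trans ((Literature.Barriers.CriticalPhenomena.LongBoxHalving_holds 3 n).trans_eq (by norm_num))

/-! ### The modulus hypotheses of S1 are load-bearing -/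

/-- **The modulus-closeness hypotheses of STUB S1 are load-bearing.** S1 with
`|crossRatio x - η| < θ → |crossRatio x' - η| < θ →` deleted (so `η, θ` idle; stated inline) is FALSE:
at `ε = 1/4` it would make the unit square (mesh `1`, `P[□, 1/2^k] ≥ 1/2`) and the thin box
`(0,1/4) × (0,1)` (mesh `1/4`, `P[▯, (1/4)/2^k] ≤ 1/8`) eventually `1/4`-close. Any proof of S1 must
therefore use the moduli (no "super-universality" across shapes). [folklore] -/
theorem stub_equicontinuousComparison_false_without_modulus :
    ¬ (∀ ε : ℝ, 0 < ε → ∀ η ∈ Set.Ioo (0 : ℝ) 1, ∃ θ : ℝ, 0 < θ ∧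
      ∀ h h' : ℝ, 0 < h → 0 < h' → ∀ R R' : ConformalRectangle,
        (∃ S : Finset (ℂ × ℂ), (∀ p ∈ S, ∃ u v : Site 2, (zdGraph 2).Adj u v ∧
            p.1 = meshPoint h u ∧ p.2 = meshPoint h v) ∧
            frontier R.carrier ⊆ ⋃ p ∈ S, segment ℝ p.1 p.2) →
        (∃ S : Finset (ℂ × ℂ), (∀ p ∈ S, ∃ u v : Site 2, (zdGraph 2).Adj u v ∧
            p.1 = meshPoint h' u ∧ p.2 = meshPoint h' v) ∧
            frontier R'.carrier ⊆ ⋃ p ∈ S, segment ℝ p.1 p.2) →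
        ∀ (φ : ConformalEquiv UpperHalfPlane.upperHalfPlaneSet R.carrier) (x : Fin 4 → ℝ)
          (φ' : ConformalEquiv UpperHalfPlane.upperHalfPlaneSet R'.carrier) (x' : Fin 4 → ℝ),
          R.IsUniformizing φ x → R'.IsUniformizing φ' x' →
          ∀ᶠ k : ℕ in atTop,
            |bondDomainCrossingProb R (h / 2 ^ k) - bondDomainCrossingProb R' (h' / 2 ^ k)| < ε) := by
  intro H
  obtain ⟨θ, -, H⟩ := H (1 / 4) (by norm_num) (1 / 2) ⟨by norm_num, by norm_num⟩
  obtain ⟨φ, x, hφ⟩ :=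
    MarkedDomain.exists_isUniformizing_holds (rectQuad 0 1 0 1 zero_lt_one zero_lt_one)
  obtain ⟨φ', x', hφ'⟩ :=
    MarkedDomain.exists_isUniformizing_holds (rectQuad 0 (1 / 4) 0 1 (by norm_num) zero_lt_one)
  have hev := H 1 (1 / 4) one_pos (by norm_num) _ _ unitSquare_isLatticePolygon thinBox_isLatticePolygon
    φ x φ' x' hφ hφ'
  obtain ⟨k, hk2, hk⟩ := ((eventually_ge_atTop 2).and hev).exists
  have h4 : 4 ≤ 2 ^ k := by
    calc 4 = 2 ^ 2 := by norm_num
      _ ≤ 2 ^ k := Nat.pow_le_pow_right (by norm_num) hk2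
  obtain ⟨n, hn⟩ : ∃ n : ℕ, (2 : ℝ) ^ k = n + 3 :=
    ⟨2 ^ k - 3, by rw [Nat.cast_sub (by omega)]; push_cast; ring⟩
  obtain ⟨n', hn'⟩ : ∃ n' : ℕ, (2 : ℝ) ^ k = n' + 2 :=
    ⟨2 ^ k - 2, by rw [Nat.cast_sub (by omega)]; push_cast; ring⟩
  have e1 : (1 : ℝ) / 2 ^ k = 1 / ((n : ℝ) + 3) := by rw [hn]
  have e2 : (1 : ℝ) / 4 / 2 ^ k = 1 / (4 * ((n' : ℝ) + 2)) := by rw [hn', div_div]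
  rw [e1, e2] at hk
  have hlo := half_le_bond_unitSquare n
  have hhi := bond_thinBox_le n'
  have := (abs_lt.1 hk).2
  linarith

end Summit.CriticalPhenomena.CardyFormulaZ2.Theorems.DyadicLatticeBetaLaw.Negative

end
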